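import Mathlib.Analysis.SpecialFunctions.Pow.Real
import Mathlib.Analysis.SpecialFunctions.Log.Basic
import Mathlib.Analysis.SpecialFunctions.Exp
import HarnessLib

/-!
# The auxiliary maximisation `AV − V log V + C V log log V ≪ e^A A^C` (Balazard–de Roton 2008, Proposition 23)

Topic `Literature/NumberTheory/LFunctions`; a brick of the reduction of
`Literature.NumberTheory.LFunctions.BalazardDeRoton2010_thm1` to the engine of Soundararajan's
method (the dyadic sum `B_N(T)` of arXiv:0810.3587 §8.4 is bounded through it). M. Balazard,
A. de Roton, arXiv:0810.3587, §8.4: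

> **Proposition 23.** Soit `A` et `C` des paramètres positifs tels que `A ≥ 4C⁴+1`. On a alors
> `AV − V log V + CV log log V ≤ e^A A^C (V > e^C)`.

We prove the slightly weaker (in the constant, which is immaterial: any absolute factor in front of
`e^A A^C` is absorbed by `δ` in the application) but more robust form
`AV − V log V + CV log log V ≤ 2^C e^A A^C` for `C ≥ 1`, `A ≥ 32C³`, `V > e^C`
(`MertensContour.linear_sub_xlogx_le`), by the elementary device `w e^{−w} ≤ e^{−1}`
(Mathlib's `Real.mul_exp_neg_le_exp_neg_one`):
with `u = log V` and `w = A + C log u − u > 0`, `e^u w = e^A u^C (w e^{−w})`, and `u < 2A` because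
`2C log u ≤ u` once `u ≥ 16C²`.

## References

* [BalazardRoton2008] M. Balazard, A. de Roton, arXiv:0810.3587, Prop. 23 (§8.4, p. 12).
-/

noncomputable section

open Real

namespace Literature.NumberTheory.LFunctions

namespace MertensContour

/-- `log u ≤ 2 √u` for `u > 0` (`log x ≤ x^ε/ε` with `ε = 1/2`). [folklore] -/
lemma log_le_two_mul_sqrt {u : ℝ} (hu : 0 < u) : Real.log u ≤ 2 * Real.sqrt u := by
  have h := Real.log_le_rpow_div hu.le (by norm_num : (0 : ℝ) < 1 / 2)
  rw [Real.sqrt_eq_rpow]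
  have e : u ^ (1 / 2 : ℝ) / (1 / 2) = 2 * u ^ (1 / 2 : ℝ) := by ring
  rwa [e] at h

/-- For `C > 0` and `u ≥ 16C²`: `2C log u ≤ u`. [folklore] -/
lemma two_mul_log_le {C u : ℝ} (hC : 0 < C) (hu : 16 * C ^ 2 ≤ u) : 2 * C * Real.log u ≤ u := by
  have hu0 : 0 < u := lt_of_lt_of_le (by positivity) hu
  have h1 := log_le_two_mul_sqrt hu0
  have hs : 4 * C ≤ Real.sqrt u := by
    rw [show (4 : ℝ) * C = Real.sqrt ((4 * C) ^ 2) by rw [Real.sqrt_sq (by positivity)]]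
    exact Real.sqrt_le_sqrt (by nlinarith)
  have hsq : Real.sqrt u * Real.sqrt u = u := Real.mul_self_sqrt hu0.le
  calc 2 * C * Real.log u ≤ 2 * C * (2 * Real.sqrt u) := mul_le_mul_of_nonneg_left h1 (by positivity)
    _ = (4 * C) * Real.sqrt u := by ring
    _ ≤ Real.sqrt u * Real.sqrt u := mul_le_mul_of_nonneg_right hs (Real.sqrt_nonneg _)
    _ = u := hsq

/-- **Balazard–de Roton 2008, Proposition 23 (robust form).** For `C ≥ 1`, `A ≥ 32 C²` and `V > e^C`:
`A V − V log V + C V log log V ≤ 2^C e^A A^C` (here with the threshold `A ≥ 32C³`). [cite: BalazardRoton2008, Prop. 23] -/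
theorem linear_sub_xlogx_le {A C V : ℝ} (hC : 1 ≤ C) (hA : 32 * C ^ 3 ≤ A) (hV : Real.exp C < V) :
    A * V - V * Real.log V + C * V * Real.log (Real.log V) ≤ (2 : ℝ) ^ C * Real.exp A * A ^ C := by
  have hC0 : 0 < C := by linarith
  have hC3 : C ^ 2 ≤ C ^ 3 := by nlinarith
  have hC1' : 1 ≤ C ^ 3 := one_le_pow₀ hC
  have hA32 : 32 ≤ A := by nlinarith
  have hA0 : 0 < A := by linarith
  have hV0 : 0 < V := (Real.exp_pos C).trans hV
  set u := Real.log V with hu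
  have huC : C < u := by
    rw [hu, ← Real.log_exp C]; exact Real.log_lt_log (Real.exp_pos C) hV
  have hu0 : 0 < u := hC0.trans huC
  have hVu : V = Real.exp u := by rw [hu, Real.exp_log hV0]
  -- rewrite the left side as `e^u (A − u + C log u)`
  have hL : A * V - V * Real.log V + C * V * Real.log (Real.log V) = Real.exp u * (A - u + C * Real.log u) := by
    rw [hVu, Real.log_exp]; ring
  rw [hL]
  have hRHS0 : 0 < (2 : ℝ) ^ C * Real.exp A * A ^ C := by positivity
  -- if the bracket is `≤ 0` we are done
  rcases le_or_gt (A - u + C * Real.log u) 0 with hneg | hposw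
  · exact le_trans (mul_nonpos_of_nonneg_of_nonpos (Real.exp_pos u).le hneg) hRHS0.le
  set w := A - u + C * Real.log u with hw
  -- case split on `u` versus `16 C²`
  rcases lt_or_ge u (16 * C ^ 2) with hsmall | hlarge
  · -- small `u`: `e^u (A + C log u) ≤ e^{A/2} · 2A ≤ e^A A^C`
    have hlogu : Real.log u ≤ u := (Real.log_le_sub_one_of_pos hu0).trans (by linarith)
    have h1 : w ≤ 2 * A := by
      rw [hw]
      have h' : C * Real.log u ≤ C * u := mul_le_mul_of_nonneg_left hlogu hC0.le
      have h'' : C * u ≤ C * (16 * C ^ 2) := mul_le_mul_of_nonneg_left hsmall.le hC0.le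
      nlinarith
    have h2 : Real.exp u ≤ Real.exp (A / 2) := Real.exp_le_exp.2 (by nlinarith)
    have h3 : Real.exp u * w ≤ Real.exp (A / 2) * (2 * A) :=
      mul_le_mul h2 h1 hposw.le (Real.exp_pos _).le
    refine h3.trans ?_
    -- `2A e^{A/2} ≤ e^A A^C ≤ 2^C e^A A^C`
    have hAC : A ≤ A ^ C := by
      have := Real.rpow_le_rpow_of_exponent_le (by linarith : (1 : ℝ) ≤ A) hC
      rwa [Real.rpow_one] at this
    have hexp : 2 * Real.exp (A / 2) ≤ Real.exp A := by
      have h4 : Real.exp A = Real.exp (A / 2) * Real.exp (A / 2) := by rw [← Real.exp_add]; ring_nf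
      have h5 : (2 : ℝ) ≤ Real.exp (A / 2) := by
        have := Real.add_one_le_exp (A / 2); linarith
      rw [h4]; nlinarith [Real.exp_pos (A / 2)]
    have h2C : (1 : ℝ) ≤ (2 : ℝ) ^ C := Real.one_le_rpow (by norm_num) hC0.le
    calc Real.exp (A / 2) * (2 * A) = (2 * Real.exp (A / 2)) * A := by ring
      _ ≤ Real.exp A * A ^ C := mul_le_mul hexp hAC hA0.le (Real.exp_pos _).le
      _ = 1 * (Real.exp A * A ^ C) := (one_mul _).symm
      _ ≤ (2 : ℝ) ^ C * (Real.exp A * A ^ C) := mul_le_mul_of_nonneg_right h2C (by positivity)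
      _ = (2 : ℝ) ^ C * Real.exp A * A ^ C := by ring
  · -- large `u`: `e^u w = e^A u^C (w e^{−w}) ≤ e^{A−1} u^C`, and `u < 2A`
    have hul : 2 * C * Real.log u ≤ u := two_mul_log_le hC0 hlarge
    have hu2A : u < 2 * A := by
      have : u < A + C * Real.log u := by rw [hw] at hposw; linarith
      linarith
    have hkey : Real.exp u * w = Real.exp A * u ^ C * (w * Real.exp (-w)) := by
      have e1 : u = A + C * Real.log u - w := by rw [hw]; ring
      have e2 : Real.exp u = Real.exp A * u ^ C * Real.exp (-w) := by
        conv_lhs => rw [e1]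
        rw [sub_eq_add_neg, Real.exp_add, Real.exp_add, Real.rpow_def_of_pos hu0, mul_comm (Real.log u) C]
      rw [e2]; ring
    rw [hkey]
    have h1 : w * Real.exp (-w) ≤ 1 := (Real.mul_exp_neg_le_exp_neg_one w).trans (by
      have := Real.exp_le_one_iff.2 (by norm_num : (-1 : ℝ) ≤ 0); exact this)
    have huC' : u ^ C ≤ (2 * A) ^ C := Real.rpow_le_rpow hu0.le hu2A.le hC0.le
    have h2AC : (2 * A) ^ C = (2 : ℝ) ^ C * A ^ C := Real.mul_rpow (by norm_num) hA0.le
    calc Real.exp A * u ^ C * (w * Real.exp (-w)) ≤ Real.exp A * u ^ C * 1 :=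
          mul_le_mul_of_nonneg_left h1 (by positivity)
      _ ≤ Real.exp A * (2 * A) ^ C := by rw [mul_one]; exact mul_le_mul_of_nonneg_left huC' (Real.exp_pos _).le
      _ = (2 : ℝ) ^ C * Real.exp A * A ^ C := by rw [h2AC]; ring

end MertensContour

end Literature.NumberTheory.LFunctions

end
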